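import Literature.Analysis.OperatorTheory.HermitianKernelSpectralTrace
import HarnessLib

/-!
# Sandwiched-insertion trace formula for a bounded Hermitian kernel (`RCLike` scalars)

Topic `Literature/Analysis/OperatorTheory`; continuation of `HermitianKernelSpectralTrace.lean` (graded trace
of powers `Tr(Θ A^{M+2})` for a MULTIPLICATION insertion `Θ`) to a GENERAL BOUNDED INSERTION.  Setting (as
there): `(X, μ)` a finite measure space, `K : X → X → 𝕜` a strongly measurable, bounded, Hermitian kernel
(`K(x, y) = conj K(y, x)`), `A` any bounded operator on `L²(X, μ; 𝕜)` with `A φ =ᵐ ∫ K(·, y) φ(y) dμ(y)`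
(compact self-adjoint, `HermitianKernelOperator.lean`), `(bᵢ)` a countable Hilbert basis of eigenvectors,
`A bᵢ = λᵢ bᵢ` with REAL `λᵢ`, and `κ f = ∫ K(·, z) f(z) dμ(z)` the pointwise operator (written out).  Now let
`B` be ANY bounded operator on `L²` such that the sandwich `A B A` is again given a.e. by a strongly
measurable bounded kernel `k_B` (`(A B A) φ =ᵐ ∫ k_B(·, y) φ(y) dμ(y)`; e.g. `B` a bounded fibrewise operator
composed with a projection, for which `B` itself has no kernel).  Then for every `M`

  `Σᵢ λᵢ^{M+4} ⟪bᵢ, B bᵢ⟫ = ∫ k_B(V 0, V 1) K(V 1, V 2) K(V 2, V 3) ⋯ K(V (M+2), V 0) dμ^{⊗(M+3)}(V)`,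

i.e. "`Tr(B A^{M+4}) = Tr((ABA) A^{M+2})`" written as the cyclic integral of the kernels `k_B, K, …, K`
(`M + 2` copies of `K`), WITHOUT trace-class theory: the two extra powers of `A` make the pointwise
spectral expansion absolutely dominated, so that only Bessel's inequality and dominated convergence on `X`
are used.

* `prod_cyclic_succ_cons` — cutting the cycle `Fin (M+3)` behind the inserted bond (pure algebra);
* `integral_cyclic_bond_insert_eq_integral_iterate_rclike` — PEELING with a heterogeneous first bond:
  `∫ k_B(V 0, V 1) ∏_{t : Fin (M+2)} K(V (t+1), V (t+2)) dμ^{⊗(M+3)} = ∫∫ k_B(x, y) (κ^[M+1] K(·, x))(y) dμ(y) dμ(x)`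
  (Fubini along `Fin.cons` twice, `ComplexKernelCyclicPeeling.lean`);
* `inner_conj_section_pow_kernelOp_of_kernel` — `⟪conj k_B(u, ·), A^j [h]⟫ = ∫ k_B(u, y) (κ^[j] h)(y) dμ(y)`;
* `hasSum_integral_kernel_mul_iterate` — the ONE-VARIABLE pointwise expansion
  `∫ k_B(x, y) (κ^[j] K(·, x))(y) dμ(y) = Σᵢ λᵢ^j (κ_B bᵢ)(x) conj((κ bᵢ)(x))` for EVERY `x` (Parseval);
* `hasSum_pow_inner_sandwich_diag_rclike` — dominated convergence on `X` with the Bessel dominant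
  `‖A‖^{M+1} (Σᵢ |(κ_B bᵢ)(x)|² + Σᵢ |(κ bᵢ)(x)|²) ≤ ‖A‖^{M+1} (C_B² + C²) μ(X)` and the identification
  `∫ conj(κ bᵢ) (κ_B bᵢ) = λᵢ ⟪bᵢ, ABA bᵢ⟫ = λᵢ³ ⟪bᵢ, B bᵢ⟫` (self-adjointness, real eigenvalues);
* `hasSum_pow_inner_sandwich_rclike` (**main**, `RCLike`) and its `𝕜 = ℂ` instance
  `hasSum_pow_inner_sandwich`.

References: B. Simon, *Trace Ideals and Their Applications* (2005), Ch. 3 (Thm. 3.1: traces of products of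
Hilbert–Schmidt operators as integrals of kernels); M. Reed, B. Simon, *Methods of Modern Mathematical
Physics I* (1980), §VI.6, Thm. VI.22–VI.23.  Mathlib + `HermitianKernelSpectralTrace.lean` (and through it
`HermitianKernelOperator.lean`, `IntegralOperatorHilbertSchmidt.lean`, `ComplexKernelCyclicPeeling.lean`) only;
no definitions. [folklore]
-/

noncomputable section

open MeasureTheory Filter Set Function
open scoped InnerProductSpace ComplexConjugate ENNReal

namespace Literature.Analysis.OperatorTheory

/-! ### Peeling the cycle with one heterogeneous bond -/

section Peeling

variable {Y : Type*}

/-- **Cutting the cycle `Fin (M+3)` behind the inserted bond.**  For `V = x ∷ ζ`, the `M + 2` homogeneous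
bonds `∏_{t : Fin (M+2)} K(V (t+1), V (t+2))` (indices in `Fin (M+3)`, the last bond is `K(V (M+2), V 0)`) are
the open path weight `∏_{i : Fin (M+1)} K(ζ i, ζ (i+1))` of `ζ` times the closing bond `K(ζ_{last}, x)` (any
commutative monoid of weights). [folklore] -/
theorem prod_cyclic_succ_cons {M₀ : Type*} [CommMonoid M₀] (K : Y → Y → M₀) (M : ℕ) (x : Y)
    (ζ : Fin (M + 2) → Y) :
    ∏ t : Fin (M + 2), K ((Fin.cons x ζ : Fin (M + 3) → Y) t.succ)
        ((Fin.cons x ζ : Fin (M + 3) → Y) (t.succ + 1)) =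
      (∏ i : Fin (M + 1), K (ζ (Fin.castSucc i)) (ζ i.succ)) * K (ζ (Fin.last (M + 1))) x := by
  rw [Fin.prod_univ_castSucc]
  congr 1
  · refine Finset.prod_congr rfl fun i _ => ?_
    rw [Fin.cons_succ, Fin.succ_castSucc, Fin.coeSucc_eq_succ, Fin.cons_succ]
  · rw [Fin.cons_succ, Fin.succ_last, Fin.last_add_one, Fin.cons_zero]

variable {𝕜 : Type*} [RCLike 𝕜] [MeasurableSpace Y] {ρ : Measure Y} [IsFiniteMeasure ρ]
  {kB K : Y → Y → 𝕜} {CB C : ℝ}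

/-- **Peeling the cycle with a heterogeneous first bond** (`RCLike`-valued kernels).  For bounded measurable
kernels `k_B, K` on a finite measure space `(Y, ρ)` and `κ f = ∫ K(·, z) f(z) dρ(z)`, the cyclic integral
over `Fin (M+3)` sites with `k_B` on the bond `0 → 1` and `K` on the remaining `M + 2` bonds is
`∫ k_B(V 0, V 1) ∏_{t : Fin (M+2)} K(V (t+1), V (t+2)) dρ^{⊗(M+3)}(V) = ∫∫ k_B(x, y) (κ^[M+1] K(·, x))(y) dρ(y) dρ(x)`:
the `M + 2` bonds from `y = V 1` back to `x = V 0` give the iterated kernel `K^{(M+2)}(y, x)` (Fubini along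
`Fin.cons` at sites `0` and `1`, then `integral_pathWeight_mul_kernel_last_eq_iterate_rclike`; the
`RCLike` analogue of `HeterogeneousCyclicPeeling.integral_cyclic_insert_one`). [folklore] -/
theorem integral_cyclic_bond_insert_eq_integral_iterate_rclike (hkB : Measurable (uncurry kB))
    (hK : Measurable (uncurry K)) (hCB : ∀ x y, ‖kB x y‖ ≤ CB) (hC : ∀ x y, ‖K x y‖ ≤ C) (M : ℕ) :
    ∫ V : Fin (M + 3) → Y, kB (V 0) (V 1) * ∏ t : Fin (M + 2), K (V t.succ) (V (t.succ + 1))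
        ∂(Measure.pi fun _ => ρ) =
      ∫ x, ∫ y, kB x y * (fun f : Y → 𝕜 => fun w => ∫ z, K w z * f z ∂ρ)^[M + 1] (fun z => K z x) y
        ∂ρ ∂ρ := by
  have hC0 : ∀ y : Y, 0 ≤ C := fun y => (norm_nonneg _).trans (hC y y)
  have hCB0 : ∀ y : Y, 0 ≤ CB := fun y => (norm_nonneg _).trans (hCB y y)
  -- Step 1: peel site `0`
  have hΦm : Measurable fun V : Fin (M + 3) → Y =>
      kB (V 0) (V 1) * ∏ t : Fin (M + 2), K (V t.succ) (V (t.succ + 1)) := by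
    refine (hkB.comp ((measurable_pi_apply (X := fun _ : Fin (M + 3) => Y) 0).prodMk
      (measurable_pi_apply (X := fun _ : Fin (M + 3) => Y) 1))).mul ?_
    refine Finset.measurable_prod _ fun t _ => ?_
    exact hK.comp ((measurable_pi_apply (X := fun _ : Fin (M + 3) => Y) t.succ).prodMk
      (measurable_pi_apply (X := fun _ : Fin (M + 3) => Y) (t.succ + 1)))
  have hΦb : ∀ V : Fin (M + 3) → Y,
      ‖kB (V 0) (V 1) * ∏ t : Fin (M + 2), K (V t.succ) (V (t.succ + 1))‖ ≤ CB * C ^ (M + 2) := by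
    intro V
    have hP : ‖∏ t : Fin (M + 2), K (V t.succ) (V (t.succ + 1))‖ ≤ C ^ (M + 2) := by
      calc ‖∏ t : Fin (M + 2), K (V t.succ) (V (t.succ + 1))‖
          ≤ ∏ t : Fin (M + 2), ‖K (V t.succ) (V (t.succ + 1))‖ := Finset.norm_prod_le _ _
        _ ≤ ∏ _t : Fin (M + 2), C := Finset.prod_le_prod (fun t _ => norm_nonneg _) fun t _ => hC _ _
        _ = C ^ (M + 2) := by simp
    rw [norm_mul]
    exact mul_le_mul (hCB _ _) hP (norm_nonneg _) (hCB0 (V 0))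
  rw [integral_pi_succ_eq_integral_cons_rclike (ρ := ρ) (M + 2) hΦm hΦb]
  refine integral_congr_ae (Eventually.of_forall fun x => ?_)
  dsimp only
  simp_rw [prod_cyclic_succ_cons K M x, Fin.cons_zero, Fin.cons_one]
  -- Step 2: peel site `1`
  have hΨm : Measurable fun ζ : Fin (M + 2) → Y => kB x (ζ 0) *
      ((∏ i : Fin (M + 1), K (ζ (Fin.castSucc i)) (ζ i.succ)) * K (ζ (Fin.last (M + 1))) x) := by
    refine (hkB.comp (measurable_const.prodMk
      (measurable_pi_apply (X := fun _ : Fin (M + 2) => Y) 0))).mul (Measurable.mul ?_ ?_)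
    · refine Finset.measurable_prod _ fun i _ => ?_
      exact hK.comp ((measurable_pi_apply (X := fun _ : Fin (M + 2) => Y) (Fin.castSucc i)).prodMk
        (measurable_pi_apply (X := fun _ : Fin (M + 2) => Y) i.succ))
    · exact hK.comp ((measurable_pi_apply (X := fun _ : Fin (M + 2) => Y) (Fin.last (M + 1))).prodMk
        measurable_const)
  have hΨb : ∀ ζ : Fin (M + 2) → Y, ‖kB x (ζ 0) *
      ((∏ i : Fin (M + 1), K (ζ (Fin.castSucc i)) (ζ i.succ)) * K (ζ (Fin.last (M + 1))) x)‖ ≤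
        CB * (C ^ (M + 1) * C) := by
    intro ζ
    have hP : ‖∏ i : Fin (M + 1), K (ζ (Fin.castSucc i)) (ζ i.succ)‖ ≤ C ^ (M + 1) := by
      calc ‖∏ i : Fin (M + 1), K (ζ (Fin.castSucc i)) (ζ i.succ)‖
          ≤ ∏ i : Fin (M + 1), ‖K (ζ (Fin.castSucc i)) (ζ i.succ)‖ := Finset.norm_prod_le _ _
        _ ≤ ∏ _i : Fin (M + 1), C := Finset.prod_le_prod (fun i _ => norm_nonneg _) fun i _ => hC _ _
        _ = C ^ (M + 1) := by simp
    rw [norm_mul, norm_mul]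
    exact mul_le_mul (hCB _ _) (mul_le_mul hP (hC _ _) (norm_nonneg _) (pow_nonneg (hC0 x) _))
      (mul_nonneg (norm_nonneg _) (norm_nonneg _)) (hCB0 x)
  rw [integral_pi_succ_eq_integral_cons_rclike (ρ := ρ) (M + 1) hΨm hΨb]
  refine integral_congr_ae (Eventually.of_forall fun y => ?_)
  dsimp only
  simp only [Fin.cons_zero, Fin.cons_succ]
  rw [integral_const_mul, integral_pathWeight_mul_kernel_last_eq_iterate_rclike (ρ := ρ) hK hC x (M + 1) y]

end Peeling

/-! ### The one-variable pointwise expansion -/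

variable {𝕜 : Type*} [RCLike 𝕜] {X : Type*} [MeasurableSpace X] {μ : Measure X} [IsFiniteMeasure μ]
  {K : X → X → 𝕜} {C : ℝ} {A : Lp 𝕜 2 μ →L[𝕜] Lp 𝕜 2 μ} {ι : Type*}
  {b : HilbertBasis ι 𝕜 (Lp 𝕜 2 μ)} {lam : ι → ℝ} {kB : X → X → 𝕜} {CB : ℝ}

/-- **`⟪conj k_B(u, ·), A^j [h]⟫ = ∫ k_B(u, y) (κ^[j] h)(y) dμ(y)`**: pairing a power of the `K`-operator `A`,
applied to the class of a bounded measurable `h`, with the `L²` section of ANOTHER bounded kernel `k_B`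
performs one honest `k_B`-integration of the iterate `κ^[j] h` (`pow_kernelOp_toLp_ae_eq_iterate_rclike`).
[folklore] -/
theorem inner_conj_section_pow_kernelOp_of_kernel (hkB : StronglyMeasurable (uncurry kB))
    (hCB : ∀ x y, ‖kB x y‖ ≤ CB)
    (hA : ∀ φ : Lp 𝕜 2 μ, (A φ : X → 𝕜) =ᵐ[μ] fun x => ∫ y, K x y * φ y ∂μ)
    {h : X → 𝕜} (hh : Measurable h) {Bh : ℝ} (hhb : ∀ x, ‖h x‖ ≤ Bh) (j : ℕ) (u : X) :
    ⟪(memLp_two_conj_kernel_section (μ := μ) hkB hCB u).toLp (fun y => conj (kB u y)),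
        (A ^ j) ((memLp_two_of_bound_rclike (μ := μ) hh hhb).toLp h)⟫_𝕜 =
      ∫ y, kB u y * ((fun f : X → 𝕜 => fun x => ∫ z, K x z * f z ∂μ)^[j] h) y ∂μ := by
  rw [← integral_kernel_mul_eq_inner hkB hCB u]
  refine integral_congr_ae ?_
  filter_upwards [pow_kernelOp_toLp_ae_eq_iterate_rclike hA hh hhb j] with y hy
  rw [hy]

/-- **One-variable pointwise expansion of the sandwiched iterated kernel**: for EVERY `x`,
`∫ k_B(x, y) (κ^[j] K(·, x))(y) dμ(y) = Σᵢ λᵢ^j (κ_B bᵢ)(x) conj((κ bᵢ)(x))`, where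
`(κ_B bᵢ)(x) = ∫ k_B(x, z) bᵢ(z) dμ(z)` and `(κ bᵢ)(x) = ∫ K(x, z) bᵢ(z) dμ(z)` (Hermitian symmetry
`K(·, x) = conj K(x, ·)`, `A^j [conj K(x, ·)] =ᵐ κ^[j] K(·, x)`, Parseval in the eigenbasis, self-adjointness
of `A^j` and real eigenvalues). [folklore] -/
theorem hasSum_integral_kernel_mul_iterate (hK : StronglyMeasurable (uncurry K))
    (hC : ∀ x y, ‖K x y‖ ≤ C) (hherm : ∀ x y, K x y = conj (K y x))
    (hA : ∀ φ : Lp 𝕜 2 μ, (A φ : X → 𝕜) =ᵐ[μ] fun x => ∫ y, K x y * φ y ∂μ)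
    (hb : ∀ i, A (b i) = (lam i : 𝕜) • b i) (hkB : StronglyMeasurable (uncurry kB))
    (hCB : ∀ x y, ‖kB x y‖ ≤ CB) (j : ℕ) (x : X) :
    HasSum (fun i => (lam i : 𝕜) ^ j * ((∫ z, kB x z * b i z ∂μ) * conj (∫ z, K x z * b i z ∂μ)))
      (∫ y, kB x y * ((fun f : X → 𝕜 => fun w => ∫ z, K w z * f z ∂μ)^[j] (fun z => K z x)) y ∂μ) := by
  set kx : Lp 𝕜 2 μ := (memLp_two_conj_kernel_section (μ := μ) hK hC x).toLp (fun z => conj (K x z))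
    with hkx
  set βx : Lp 𝕜 2 μ := (memLp_two_conj_kernel_section (μ := μ) hkB hCB x).toLp (fun z => conj (kB x z))
    with hβx
  have hKx : (fun z => K z x) = fun z => conj (K x z) := funext fun z => hherm z x
  have e1 : ∫ y, kB x y * ((fun f : X → 𝕜 => fun w => ∫ z, K w z * f z ∂μ)^[j] (fun z => K z x)) y ∂μ =
      ⟪βx, (A ^ j) kx⟫_𝕜 := by
    rw [hKx]
    exact (inner_conj_section_pow_kernelOp_of_kernel hkB hCB hA (measurable_conj_kernel_section hK x)
      (norm_conj_kernel_section_le hC x) j x).symm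
  rw [e1]
  have hsa : IsSelfAdjoint (A ^ j) := (isSelfAdjoint_of_ae_hermitianKernel hK hC hherm hA).pow j
  have h := b.hasSum_inner_mul_inner βx ((A ^ j) kx)
  refine h.congr_fun fun i => ?_
  have h2 : ⟪b i, (A ^ j) kx⟫_𝕜 = (lam i : 𝕜) ^ j * ⟪b i, kx⟫_𝕜 := by
    rw [← hsa.adjoint_eq, ContinuousLinearMap.adjoint_inner_right, pow_apply_basis_rclike hb j i,
      inner_smul_left, ← RCLike.ofReal_pow, RCLike.conj_ofReal, RCLike.ofReal_pow]
  rw [h2, ← inner_conj_symm (b i) kx, ← integral_kernel_mul_eq_inner hK hC x (b i),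
    ← integral_kernel_mul_eq_inner hkB hCB x (b i)]
  ring

/-! ### The sandwiched trace formula -/

/-- **Sandwiched-insertion trace formula, diagonal form.**  For a bounded Hermitian kernel `K` with `L²`
operator `A`, a countable Hilbert basis of eigenvectors `A bᵢ = λᵢ bᵢ` (real `λᵢ`), a bounded operator `B`
whose sandwich `A B A` is given a.e. by the bounded strongly measurable kernel `k_B`, and every `M`:
`Σᵢ λᵢ^{M+4} ⟪bᵢ, B bᵢ⟫ = ∫∫ k_B(x, y) (κ^[M+1] K(·, x))(y) dμ(y) dμ(x)` ("`Tr(B A^{M+4})`" as the diagonal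
integral of the kernel of `(ABA) A^{M+2}`): the pointwise expansion `hasSum_integral_kernel_mul_iterate`
integrated by dominated convergence (dominant `‖A‖^{M+1} (|(κ_B bᵢ)(x)|² + |(κ bᵢ)(x)|²)`, summing to at most
`‖A‖^{M+1} (C_B² + C²) μ(X)` by Bessel), and the terms identified through `κ bᵢ =ᵐ λᵢ bᵢ`,
`κ_B bᵢ =ᵐ A B A bᵢ`, `⟪bᵢ, A B A bᵢ⟫ = ⟪A bᵢ, B A bᵢ⟫ = λᵢ² ⟪bᵢ, B bᵢ⟫`. [folklore] -/
theorem hasSum_pow_inner_sandwich_diag_rclike [Countable ι] (hK : StronglyMeasurable (uncurry K))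
    (hC : ∀ x y, ‖K x y‖ ≤ C) (hherm : ∀ x y, K x y = conj (K y x))
    (hA : ∀ φ : Lp 𝕜 2 μ, (A φ : X → 𝕜) =ᵐ[μ] fun x => ∫ y, K x y * φ y ∂μ)
    (hb : ∀ i, A (b i) = (lam i : 𝕜) • b i) {B : Lp 𝕜 2 μ →L[𝕜] Lp 𝕜 2 μ}
    (hkB : StronglyMeasurable (uncurry kB)) (hCB : ∀ x y, ‖kB x y‖ ≤ CB)
    (hABA : ∀ φ : Lp 𝕜 2 μ, ((A.comp (B.comp A)) φ : X → 𝕜) =ᵐ[μ] fun x => ∫ y, kB x y * φ y ∂μ)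
    (M : ℕ) :
    HasSum (fun i => (lam i : 𝕜) ^ (M + 4) * ⟪(b i : Lp 𝕜 2 μ), B (b i)⟫_𝕜)
      (∫ x, ∫ y, kB x y * ((fun f : X → 𝕜 => fun w => ∫ z, K w z * f z ∂μ)^[M + 1] (fun z => K z x)) y
        ∂μ ∂μ) := by
  -- notation: `cf i x = (κ bᵢ)(x)`, `cB i x = (κ_B bᵢ)(x)`, terms `F`, dominant `bd`
  set cf : ι → X → 𝕜 := fun i x => ∫ z, K x z * b i z ∂μ with hcf
  set cB : ι → X → 𝕜 := fun i x => ∫ z, kB x z * b i z ∂μ with hcB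
  set F : ι → X → 𝕜 := fun i x => (lam i : 𝕜) ^ (M + 1) * (cB i x * conj (cf i x)) with hF
  set bd : ι → X → ℝ := fun i x => ‖A‖ ^ (M + 1) * (‖cB i x‖ ^ 2 + ‖cf i x‖ ^ 2) with hbd
  have hcfm : ∀ i, Measurable (cf i) := fun i => (stronglyMeasurable_integral_kernel_mul hK (b i)).measurable
  have hcBm : ∀ i, Measurable (cB i) := fun i =>
    (stronglyMeasurable_integral_kernel_mul hkB (b i)).measurable
  have hFm : ∀ i, Measurable (F i) := fun i =>
    ((hcBm i).mul (RCLike.continuous_conj.measurable.comp (hcfm i))).const_mul _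
  have hlamA : ∀ i, ‖(lam i : 𝕜)‖ ≤ ‖A‖ := norm_eigval_le_opNorm hb
  -- (0) pointwise expansion
  have hpt : ∀ x, HasSum (fun i => F i x)
      (∫ y, kB x y * ((fun f : X → 𝕜 => fun w => ∫ z, K w z * f z ∂μ)^[M + 1] (fun z => K z x)) y ∂μ) :=
    fun x => hasSum_integral_kernel_mul_iterate hK hC hherm hA hb hkB hCB (M + 1) x
  -- (1) domination
  have hbound : ∀ i x, ‖F i x‖ ≤ bd i x := fun i x => by
    simp only [hF, hbd]
    rw [norm_mul, norm_mul, norm_pow, RCLike.norm_conj]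
    have h2 : ‖(lam i : 𝕜)‖ ^ (M + 1) ≤ ‖A‖ ^ (M + 1) := pow_le_pow_left₀ (norm_nonneg _) (hlamA i) _
    have h3 : ‖cB i x‖ * ‖cf i x‖ ≤ ‖cB i x‖ ^ 2 + ‖cf i x‖ ^ 2 := by
      nlinarith [two_mul_le_add_sq ‖cB i x‖ ‖cf i x‖, mul_nonneg (norm_nonneg (cB i x))
        (norm_nonneg (cf i x))]
    exact mul_le_mul h2 h3 (by positivity) (by positivity)
  have hparsK : ∀ x, Summable (fun i => ‖cf i x‖ ^ 2) ∧ ∑' i, ‖cf i x‖ ^ 2 = ∫ z, ‖K x z‖ ^ 2 ∂μ ∧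
      ∫ z, ‖K x z‖ ^ 2 ∂μ ≤ C ^ 2 * μ.real univ := fun x => tsum_norm_sq_integral_kernel_mul_le hK hC b x
  have hparsB : ∀ x, Summable (fun i => ‖cB i x‖ ^ 2) ∧ ∑' i, ‖cB i x‖ ^ 2 = ∫ z, ‖kB x z‖ ^ 2 ∂μ ∧
      ∫ z, ‖kB x z‖ ^ 2 ∂μ ≤ CB ^ 2 * μ.real univ := fun x =>
    tsum_norm_sq_integral_kernel_mul_le hkB hCB b x
  have hbd_sum : ∀ x, Summable fun i => bd i x := fun x =>
    ((hparsB x).1.add (hparsK x).1).mul_left _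
  have hsqK : Measurable fun x => ∫ z, ‖K x z‖ ^ 2 ∂μ :=
    (stronglyMeasurable_integral_norm_kernel_sq hK).measurable
  have hsqB : Measurable fun x => ∫ z, ‖kB x z‖ ^ 2 ∂μ :=
    (stronglyMeasurable_integral_norm_kernel_sq hkB).measurable
  have hbd_int : Integrable (fun x => ∑' i, bd i x) μ := by
    have hfun : (fun x => ∑' i, bd i x) =
        fun x => ‖A‖ ^ (M + 1) * (∫ z, ‖kB x z‖ ^ 2 ∂μ + ∫ z, ‖K x z‖ ^ 2 ∂μ) := by
      funext x
      simp only [hbd]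
      rw [tsum_mul_left, (hparsB x).1.tsum_add (hparsK x).1, (hparsB x).2.1, (hparsK x).2.1]
    rw [hfun]
    refine (Integrable.of_bound (hsqB.add hsqK).aestronglyMeasurable ((CB ^ 2 + C ^ 2) * μ.real univ)
      (Eventually.of_forall fun x => ?_)).const_mul _
    rw [Real.norm_eq_abs, abs_of_nonneg (add_nonneg (integral_nonneg fun z => by positivity)
      (integral_nonneg fun z => by positivity))]
    calc ∫ z, ‖kB x z‖ ^ 2 ∂μ + ∫ z, ‖K x z‖ ^ 2 ∂μ ≤ CB ^ 2 * μ.real univ + C ^ 2 * μ.real univ :=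
          add_le_add (hparsB x).2.2 (hparsK x).2.2
      _ = (CB ^ 2 + C ^ 2) * μ.real univ := by ring
  have key := hasSum_integral_of_dominated_convergence (μ := μ) bd
    (fun i => (hFm i).aestronglyMeasurable) (fun i => Eventually.of_forall (hbound i))
    (Eventually.of_forall hbd_sum) hbd_int (Eventually.of_forall hpt)
  -- (2) the terms: `∫ λᵢ^{M+1} (κ_B bᵢ) conj(κ bᵢ) = λᵢ^{M+4} ⟪bᵢ, B bᵢ⟫`
  have hsa : IsSelfAdjoint A := isSelfAdjoint_of_ae_hermitianKernel hK hC hherm hA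
  refine key.congr_fun fun i => ?_
  have hI : ∫ x, cB i x * conj (cf i x) ∂μ = (lam i : 𝕜) * ⟪b i, (A.comp (B.comp A)) (b i)⟫_𝕜 := by
    rw [inner_eq_integral_of_ae_kernel hABA (b i) (b i), ← integral_const_mul]
    refine integral_congr_ae ?_
    filter_upwards [integral_kernel_mul_basis_ae_eq hA hb i] with x hx
    simp only [hcB, hcf] at hx ⊢
    rw [hx, map_mul, RCLike.conj_ofReal]
    ring
  have hABAi : ⟪b i, (A.comp (B.comp A)) (b i)⟫_𝕜 = (lam i : 𝕜) ^ 2 * ⟪b i, B (b i)⟫_𝕜 := by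
    have h0 := ContinuousLinearMap.adjoint_inner_left A (B (A (b i))) (b i)
    rw [hsa.adjoint_eq] at h0
    rw [ContinuousLinearMap.comp_apply, ContinuousLinearMap.comp_apply, ← h0, hb i, map_smul,
      inner_smul_left, inner_smul_right, RCLike.conj_ofReal]
    ring
  simp only [hF]
  rw [integral_const_mul, hI, hABAi]
  ring

/-- **Sandwiched-insertion trace formula as a periodic path integral** (`RCLike` scalars).  For a bounded,
strongly measurable, Hermitian kernel `K` on a finite measure space with `L²` operator `A`, a countable Hilbert
basis of eigenvectors `A bᵢ = λᵢ bᵢ` (real `λᵢ`), ANY bounded operator `B` such that `A B A` is given a.e. by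
a bounded strongly measurable kernel `k_B`, and every `M`:
`Σᵢ λᵢ^{M+4} ⟪bᵢ, B bᵢ⟫ = ∫ k_B(V 0, V 1) ∏_{t : Fin (M+2)} K(V (t+1), V (t+2)) dμ^{⊗(M+3)}(V)` — the cyclic
integral of the kernels `k_B, K, …, K` (`M + 2` copies of `K`, the last bond `K(V (M+2), V 0)`), i.e.
"`Tr(B A^{M+4})`" without trace-class theory (`integral_cyclic_bond_insert_eq_integral_iterate_rclike` and
`hasSum_pow_inner_sandwich_diag_rclike`). [folklore] -/
theorem hasSum_pow_inner_sandwich_rclike [Countable ι] (hK : StronglyMeasurable (uncurry K))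
    (hC : ∀ x y, ‖K x y‖ ≤ C) (hherm : ∀ x y, K x y = conj (K y x))
    (hA : ∀ φ : Lp 𝕜 2 μ, (A φ : X → 𝕜) =ᵐ[μ] fun x => ∫ y, K x y * φ y ∂μ)
    (hb : ∀ i, A (b i) = (lam i : 𝕜) • b i) {B : Lp 𝕜 2 μ →L[𝕜] Lp 𝕜 2 μ}
    (hkB : StronglyMeasurable (uncurry kB)) (hCB : ∀ x y, ‖kB x y‖ ≤ CB)
    (hABA : ∀ φ : Lp 𝕜 2 μ, ((A.comp (B.comp A)) φ : X → 𝕜) =ᵐ[μ] fun x => ∫ y, kB x y * φ y ∂μ)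
    (M : ℕ) :
    HasSum (fun i => (lam i : 𝕜) ^ (M + 4) * ⟪(b i : Lp 𝕜 2 μ), B (b i)⟫_𝕜)
      (∫ V : Fin (M + 3) → X, kB (V 0) (V 1) * ∏ t : Fin (M + 2), K (V t.succ) (V (t.succ + 1))
        ∂(Measure.pi fun _ => μ)) := by
  rw [integral_cyclic_bond_insert_eq_integral_iterate_rclike (ρ := μ) hkB.measurable hK.measurable hCB hC M]
  exact hasSum_pow_inner_sandwich_diag_rclike hK hC hherm hA hb hkB hCB hABA M

/-- **Sandwiched-insertion trace formula for a bounded Hermitian complex kernel.**  For `K : X → X → ℂ`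
strongly measurable, bounded and Hermitian on a finite measure space, ANY bounded operator `T` on
`L²(X, μ; ℂ)` with `(Tφ)(x) = ∫ K(x, y) φ(y) dμ(y)` a.e. (compact self-adjoint, `exists_hermitianKernelOp`),
any countable Hilbert basis `e` of eigenvectors with real eigenvalues `ev`, any bounded operator `S` whose
sandwich `T S T` has a bounded strongly measurable kernel `kS`, and every `M`:
`Σᵢ evᵢ^{M+4} ⟪eᵢ, S eᵢ⟫ = ∫ kS(V 0, V 1) ∏_{t : Fin (M+2)} K(V (t+1), V (t+2)) dμ^{⊗(M+3)}(V)`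
("`Tr(S T^{M+4})`"; `hasSum_pow_inner_sandwich_rclike` at `𝕜 = ℂ`, `conj = starRingEnd ℂ`; B. Simon,
*Trace Ideals* (2005), Ch. 3; Reed–Simon I, §VI.6). [folklore] -/
theorem hasSum_pow_inner_sandwich : ∀ {X : Type*} [MeasurableSpace X] (μ : Measure X)
    [IsFiniteMeasure μ] (K : X → X → ℂ) (C : ℝ), StronglyMeasurable (uncurry K) → (∀ x y, ‖K x y‖ ≤ C) →
    (∀ x y, K x y = conj (K y x)) →
    ∀ (T : Lp ℂ 2 μ →L[ℂ] Lp ℂ 2 μ),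
      (∀ φ : Lp ℂ 2 μ, (T φ : X → ℂ) =ᵐ[μ] fun x => ∫ y, K x y * φ y ∂μ) →
      ∀ {ι : Type*} [Countable ι] (e : HilbertBasis ι ℂ (Lp ℂ 2 μ)) (ev : ι → ℝ),
        (∀ i, T (e i) = (ev i : ℂ) • (e i : Lp ℂ 2 μ)) →
        ∀ (S : Lp ℂ 2 μ →L[ℂ] Lp ℂ 2 μ) (kS : X → X → ℂ) (CS : ℝ),
          StronglyMeasurable (uncurry kS) → (∀ x y, ‖kS x y‖ ≤ CS) →
          (∀ φ : Lp ℂ 2 μ, ((T.comp (S.comp T)) φ : X → ℂ) =ᵐ[μ] fun x => ∫ y, kS x y * φ y ∂μ) →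
          ∀ M : ℕ, HasSum (fun i => (ev i : ℂ) ^ (M + 4) * ⟪(e i : Lp ℂ 2 μ), S (e i)⟫_ℂ)
            (∫ V : Fin (M + 3) → X, kS (V 0) (V 1) * ∏ t : Fin (M + 2), K (V t.succ) (V (t.succ + 1))
              ∂(Measure.pi fun _ => μ)) := by
  intro X _ μ _ K C hK hC hherm T hT ι _ e ev he S kS CS hkS hCS hTST M
  exact hasSum_pow_inner_sandwich_rclike hK hC hherm hT he hkS hCS hTST M

end Literature.Analysis.OperatorTheory

end
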